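import Literature.Computability.FineGrained.IPRenameOccBricks
import HarnessLib

/-!
# The renaming machine of Impagliazzo–Paturi's Lemma 2, XI: a new variable of the occurrence table (count, colour, record)

Family `fine-grained` (trunk T-CPLX-FINE). Eleventh file of the machine half of Impagliazzo–Paturi's Lemma 2. The occurrence table lists
the occurring variables in the order of first occurrence (`IPRename.occList`) with their light
flag (`occ F x ≤ cap`) and greedy colour (`IPRename.col`). This file handles ONE new variable `x`.

* `xPass` / **`runs_xPass`** — one pass over the clauses: count the clauses containing `x`
  (`cnt := ticks (occ F x)`) and collect the colours of the earlier light variables co-occurring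
  with `x` (`colsL`, by a lookup `findRec` of every literal in the table so far);
* `colsL_eq`, `s2L_reverse`, `mem_forbW`, `freshNat_congr`, **`col_eq_freshNat_forbW`**: the
  collected list has the membership of the list in `IPRename.col_spec`, so its least free colour
  is `col F cap x` — provided the table holds exactly `pre F x`;
* `buildRec` / `runs_buildRec` (append the record), `newVar cap` / **`runs_newVar`**: the table of
  `zs` becomes the table of `zs ++ [x]` (`ocRecs`, `ocPay`), cost `nvCost`.

## References

* R. Impagliazzo, R. Paturi, *On the complexity of k-SAT*, J. Comput. System Sci. 62 (2001)
  367–375, doi:10.1006/jcss.2000.1727, Lemma 2 (p. 373) and its "Moreover" sentence (the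
  reduction is computable within the stated time); pp. 371–372 (`G_x`, `Ψ`, `Θ_i`, `Φ_f`).
  (Not held; acquisition request acq-00143.)
* T. Nipkow, G. Klein, *Concrete Semantics with Isabelle/HOL*, Springer 2014, Ch. 7 (big-step
  reasoning about loops, as in `SymbolPrograms.lean`).
-/

namespace Literature.Computability.FineGrained.IPRenameM

open _root_.Computability Complexity Complexity.ACom Sparsifier IPRename
open Compaction (uflag uflag_true uflag_false)

/-! ### The pass over the clauses for a new variable `x`: occurrence count and forbidden colours -/

/-- Use the record found for the literal's variable: if found and light, its colour kets go to the
candidate list `s2`; otherwise discard. [folklore] -/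
def useRec : RProg :=
  pop (kr KR.fnd) fun o => match o with
    | some _ => pop (kr KR.key) fun o' => match o' with
        | some (Γ'.bit true) => moveKets
        | some _ => clear (kr KR.key)
        | none => skip
    | none => skip

/-- At the comma closing a literal on `u` (bits reversed in `ex` and `ju`): compare with `x`
(raise `fl` on a match), look `u` up in the occurrence table, use the record, restore the probe
of `x` from `pr2`. [folklore] -/
def litEndX : RProg :=
  (eqW Γ'.blank).map embEq ;;
  (pop (kr KR.ne) fun o => match o with
    | some _ => skip
    | none => setFlagG Γ'.blank (kr KR.fl)) ;;
  clear (kr KR.pr) ;; copyToG (kr KR.ju) (kr KR.pr) (kr KR.t1) (kr KR.t2) ;; clear (kr KR.ju) ;;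
  findRec KR.oc ;; useRec ;; clear (kr KR.pr) ;; copyToG (kr KR.pr2) (kr KR.pr) (kr KR.t1) (kr KR.t2)

/-- Append the candidate list to the colour list (symbol by symbol, which restores key-first
blocks). [folklore] -/
def appendCand : RProg := loop (kr KR.s2) fun s => push (kr KR.cols) s

/-- At the `ket` closing a clause: if it contained `x`, count it and keep its candidates.
[folklore] -/
def clauseEndX : RProg :=
  pop (kr KR.fl) fun o => match o with
    | some _ => push (kr KR.cnt) Γ'.blank ;; appendCand
    | none => clear (kr KR.s2)

/-- Body of the pass over the copy `s1` of the clause list (mode `md`: empty = between literals —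
a polarity bit opens a literal, `bra` opens and `ket` closes a clause —, `blank` = inside the index
bits of a literal). [folklore] -/
def xBody (s : Γ') : RProg :=
  pop (kr KR.md) fun o => match o, s with
    | none, Γ'.bit _ => push (kr KR.md) Γ'.blank
    | none, Γ'.ket => clauseEndX
    | none, _ => skip
    | some _, Γ'.bit d => push (kr KR.ex) (Γ'.bit d) ;; push (kr KR.ju) (Γ'.bit d) ;; push (kr KR.md) Γ'.blank
    | some _, Γ'.comma => litEndX
    | some _, _ => skip

/-- `xPass`: one pass over the clauses for the new variable `x` (probe in `pr` and `pr2`).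
[folklore] -/
def xPass : RProg := copyToG (kr KR.fam) (kr KR.s1) (kr KR.t1) (kr KR.t2) ;; loop (kr KR.s1) xBody

/-! ### Functional description -/

/-- The occurrence record of a variable: light flag and colour. [folklore] -/
def ocPay (F : List (List (ℕ × Bool))) (cap z : ℕ) : List Γ' :=
  Γ'.bit (decide (occ F z ≤ cap)) :: List.replicate (col F cap z) Γ'.ket

/-- The occurrence table of a list of variables. [folklore] -/
def ocRecs (F : List (List (ℕ × Bool))) (cap : ℕ) (zs : List ℕ) : List (ℕ × List Γ') := zs.map fun z => (z, ocPay F cap z)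

/-- The candidate colours of a clause: the colours of its light literals among `zs`, in order.
[folklore] -/
def candOf (F : List (List (ℕ × Bool))) (cap : ℕ) (zs : List ℕ) (c : List (ℕ × Bool)) : List ℕ :=
  c.filterMap fun l => if l.1 ∈ zs ∧ occ F l.1 ≤ cap then some (col F cap l.1) else none

/-- The candidate register after the literals `c`: comma-first blocks, last first. [folklore] -/
def s2W (cs : List ℕ) : List Γ' := cs.foldl (fun acc cc => Γ'.comma :: (List.replicate cc Γ'.ket ++ acc)) []

/-- The forbidden colours collected for `x` over the clauses `G` (latest clause first).
[folklore] -/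
def forbW (F : List (List (ℕ × Bool))) (cap : ℕ) (zs : List ℕ) (x : ℕ) (G : List (List (ℕ × Bool))) : List ℕ :=
  (G.filter (occursIn x)).reverse.flatMap (candOf F cap zs)

/-- The store family `xSt` over a base store. [folklore] -/
def xSt (S : RStore) (s1 md ex ju fl cnt s2 cols pr ne fnd key : List Γ') : RStore := fun r =>
  if r = kr KR.s1 then s1 else if r = kr KR.md then md else if r = kr KR.ex then ex else if r = kr KR.ju then ju else if r = kr KR.fl then fl else if r = kr KR.cnt then cnt else if r = kr KR.s2 then s2 else if r = kr KR.cols then cols else if r = kr KR.pr then pr else if r = kr KR.ne then ne else if r = kr KR.fnd then fnd else if r = kr KR.key then key else S r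

section XstLemmas

variable (S : RStore) (s1 md ex ju fl cnt s2 cols pr ne fnd key w : List Γ')

/-- Reading `s1`. [folklore] -/
@[simp] theorem xSt_s1 : xSt S s1 md ex ju fl cnt s2 cols pr ne fnd key (kr KR.s1) = s1 := by simp [xSt]
/-- Reading `md`. [folklore] -/
@[simp] theorem xSt_md : xSt S s1 md ex ju fl cnt s2 cols pr ne fnd key (kr KR.md) = md := by simp [xSt]
/-- Reading `ex`. [folklore] -/
@[simp] theorem xSt_ex : xSt S s1 md ex ju fl cnt s2 cols pr ne fnd key (kr KR.ex) = ex := by simp [xSt]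
/-- Reading `ju`. [folklore] -/
@[simp] theorem xSt_ju : xSt S s1 md ex ju fl cnt s2 cols pr ne fnd key (kr KR.ju) = ju := by simp [xSt]
/-- Reading `fl`. [folklore] -/
@[simp] theorem xSt_fl : xSt S s1 md ex ju fl cnt s2 cols pr ne fnd key (kr KR.fl) = fl := by simp [xSt]
/-- Reading `cnt`. [folklore] -/
@[simp] theorem xSt_cnt : xSt S s1 md ex ju fl cnt s2 cols pr ne fnd key (kr KR.cnt) = cnt := by simp [xSt]
/-- Reading `s2`. [folklore] -/
@[simp] theorem xSt_s2 : xSt S s1 md ex ju fl cnt s2 cols pr ne fnd key (kr KR.s2) = s2 := by simp [xSt]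
/-- Reading `cols`. [folklore] -/
@[simp] theorem xSt_cols : xSt S s1 md ex ju fl cnt s2 cols pr ne fnd key (kr KR.cols) = cols := by simp [xSt]
/-- Reading `pr`. [folklore] -/
@[simp] theorem xSt_pr : xSt S s1 md ex ju fl cnt s2 cols pr ne fnd key (kr KR.pr) = pr := by simp [xSt]
/-- Reading `ne`. [folklore] -/
@[simp] theorem xSt_ne : xSt S s1 md ex ju fl cnt s2 cols pr ne fnd key (kr KR.ne) = ne := by simp [xSt]
/-- Reading `fnd`. [folklore] -/
@[simp] theorem xSt_fnd : xSt S s1 md ex ju fl cnt s2 cols pr ne fnd key (kr KR.fnd) = fnd := by simp [xSt]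
/-- Reading `key`. [folklore] -/
@[simp] theorem xSt_key : xSt S s1 md ex ju fl cnt s2 cols pr ne fnd key (kr KR.key) = key := by simp [xSt]
/-- Reading any other register. [folklore] -/
theorem xSt_other {r : Reg} (h0 : r ≠ kr KR.s1) (h1 : r ≠ kr KR.md) (h2 : r ≠ kr KR.ex) (h3 : r ≠ kr KR.ju) (h4 : r ≠ kr KR.fl) (h5 : r ≠ kr KR.cnt) (h6 : r ≠ kr KR.s2) (h7 : r ≠ kr KR.cols) (h8 : r ≠ kr KR.pr) (h9 : r ≠ kr KR.ne) (h10 : r ≠ kr KR.fnd) (h11 : r ≠ kr KR.key) :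
    xSt S s1 md ex ju fl cnt s2 cols pr ne fnd key r = S r := by simp [xSt, h0, h1, h2, h3, h4, h5, h6, h7, h8, h9, h10, h11]
/-- Reading `pr2`. [folklore] -/
@[simp] theorem xSt_pr2 : xSt S s1 md ex ju fl cnt s2 cols pr ne fnd key (kr KR.pr2) = S (kr KR.pr2) := by simp [xSt]
/-- Reading `oc`. [folklore] -/
@[simp] theorem xSt_oc : xSt S s1 md ex ju fl cnt s2 cols pr ne fnd key (kr KR.oc) = S (kr KR.oc) := by simp [xSt]
/-- Reading `fam`. [folklore] -/
@[simp] theorem xSt_fam : xSt S s1 md ex ju fl cnt s2 cols pr ne fnd key (kr KR.fam) = S (kr KR.fam) := by simp [xSt]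
/-- Reading `t1`. [folklore] -/
@[simp] theorem xSt_t1 : xSt S s1 md ex ju fl cnt s2 cols pr ne fnd key (kr KR.t1) = S (kr KR.t1) := by simp [xSt]
/-- Reading `t2`. [folklore] -/
@[simp] theorem xSt_t2 : xSt S s1 md ex ju fl cnt s2 cols pr ne fnd key (kr KR.t2) = S (kr KR.t2) := by simp [xSt]
/-- Reading `x2`. [folklore] -/
@[simp] theorem xSt_x2 : xSt S s1 md ex ju fl cnt s2 cols pr ne fnd key (kr KR.x2) = S (kr KR.x2) := by simp [xSt]
/-- Reading `vw`. [folklore] -/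
@[simp] theorem xSt_vw : xSt S s1 md ex ju fl cnt s2 cols pr ne fnd key (kr KR.vw) = S (kr KR.vw) := by simp [xSt]
/-- Reading `eb`. [folklore] -/
@[simp] theorem xSt_eb : xSt S s1 md ex ju fl cnt s2 cols pr ne fnd key (kr KR.eb) = S (kr KR.eb) := by simp [xSt]
/-- Reading `lmd`. [folklore] -/
@[simp] theorem xSt_lmd : xSt S s1 md ex ju fl cnt s2 cols pr ne fnd key (kr KR.lmd) = S (kr KR.lmd) := by simp [xSt]
/-- Reading `dict2`. [folklore] -/
@[simp] theorem xSt_dict2 : xSt S s1 md ex ju fl cnt s2 cols pr ne fnd key (kr KR.dict2) = S (kr KR.dict2) := by simp [xSt]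
/-- Updating `s1`. [folklore] -/
@[simp] theorem update_xSt_s1 : Function.update (xSt S s1 md ex ju fl cnt s2 cols pr ne fnd key) (kr KR.s1) w = xSt S w md ex ju fl cnt s2 cols pr ne fnd key := by
  funext r; by_cases h : r = kr KR.s1
  · subst h; simp
  · rw [Function.update_of_ne h]; simp [xSt, h]
/-- Updating `md`. [folklore] -/
@[simp] theorem update_xSt_md : Function.update (xSt S s1 md ex ju fl cnt s2 cols pr ne fnd key) (kr KR.md) w = xSt S s1 w ex ju fl cnt s2 cols pr ne fnd key := by
  funext r; by_cases h : r = kr KR.md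
  · subst h; simp
  · rw [Function.update_of_ne h]; simp [xSt, h]
/-- Updating `ex`. [folklore] -/
@[simp] theorem update_xSt_ex : Function.update (xSt S s1 md ex ju fl cnt s2 cols pr ne fnd key) (kr KR.ex) w = xSt S s1 md w ju fl cnt s2 cols pr ne fnd key := by
  funext r; by_cases h : r = kr KR.ex
  · subst h; simp
  · rw [Function.update_of_ne h]; simp [xSt, h]
/-- Updating `ju`. [folklore] -/
@[simp] theorem update_xSt_ju : Function.update (xSt S s1 md ex ju fl cnt s2 cols pr ne fnd key) (kr KR.ju) w = xSt S s1 md ex w fl cnt s2 cols pr ne fnd key := by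
  funext r; by_cases h : r = kr KR.ju
  · subst h; simp
  · rw [Function.update_of_ne h]; simp [xSt, h]
/-- Updating `fl`. [folklore] -/
@[simp] theorem update_xSt_fl : Function.update (xSt S s1 md ex ju fl cnt s2 cols pr ne fnd key) (kr KR.fl) w = xSt S s1 md ex ju w cnt s2 cols pr ne fnd key := by
  funext r; by_cases h : r = kr KR.fl
  · subst h; simp
  · rw [Function.update_of_ne h]; simp [xSt, h]
/-- Updating `cnt`. [folklore] -/
@[simp] theorem update_xSt_cnt : Function.update (xSt S s1 md ex ju fl cnt s2 cols pr ne fnd key) (kr KR.cnt) w = xSt S s1 md ex ju fl w s2 cols pr ne fnd key := by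
  funext r; by_cases h : r = kr KR.cnt
  · subst h; simp
  · rw [Function.update_of_ne h]; simp [xSt, h]
/-- Updating `s2`. [folklore] -/
@[simp] theorem update_xSt_s2 : Function.update (xSt S s1 md ex ju fl cnt s2 cols pr ne fnd key) (kr KR.s2) w = xSt S s1 md ex ju fl cnt w cols pr ne fnd key := by
  funext r; by_cases h : r = kr KR.s2
  · subst h; simp
  · rw [Function.update_of_ne h]; simp [xSt, h]
/-- Updating `cols`. [folklore] -/
@[simp] theorem update_xSt_cols : Function.update (xSt S s1 md ex ju fl cnt s2 cols pr ne fnd key) (kr KR.cols) w = xSt S s1 md ex ju fl cnt s2 w pr ne fnd key := by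
  funext r; by_cases h : r = kr KR.cols
  · subst h; simp
  · rw [Function.update_of_ne h]; simp [xSt, h]
/-- Updating `pr`. [folklore] -/
@[simp] theorem update_xSt_pr : Function.update (xSt S s1 md ex ju fl cnt s2 cols pr ne fnd key) (kr KR.pr) w = xSt S s1 md ex ju fl cnt s2 cols w ne fnd key := by
  funext r; by_cases h : r = kr KR.pr
  · subst h; simp
  · rw [Function.update_of_ne h]; simp [xSt, h]
/-- Updating `ne`. [folklore] -/
@[simp] theorem update_xSt_ne : Function.update (xSt S s1 md ex ju fl cnt s2 cols pr ne fnd key) (kr KR.ne) w = xSt S s1 md ex ju fl cnt s2 cols pr w fnd key := by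
  funext r; by_cases h : r = kr KR.ne
  · subst h; simp
  · rw [Function.update_of_ne h]; simp [xSt, h]
/-- Updating `fnd`. [folklore] -/
@[simp] theorem update_xSt_fnd : Function.update (xSt S s1 md ex ju fl cnt s2 cols pr ne fnd key) (kr KR.fnd) w = xSt S s1 md ex ju fl cnt s2 cols pr ne w key := by
  funext r; by_cases h : r = kr KR.fnd
  · subst h; simp
  · rw [Function.update_of_ne h]; simp [xSt, h]
/-- Updating `key`. [folklore] -/
@[simp] theorem update_xSt_key : Function.update (xSt S s1 md ex ju fl cnt s2 cols pr ne fnd key) (kr KR.key) w = xSt S s1 md ex ju fl cnt s2 cols pr ne fnd w := by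
  funext r; by_cases h : r = kr KR.key
  · subst h; simp
  · rw [Function.update_of_ne h]; simp [xSt, h]

end XstLemmas

/-- Every store is a `xSt` over itself. [folklore] -/
theorem xSt_eta (R : RStore) : xSt R (R (kr KR.s1)) (R (kr KR.md)) (R (kr KR.ex)) (R (kr KR.ju)) (R (kr KR.fl)) (R (kr KR.cnt)) (R (kr KR.s2)) (R (kr KR.cols)) (R (kr KR.pr)) (R (kr KR.ne)) (R (kr KR.fnd)) (R (kr KR.key)) = R := by
  funext r
  by_cases h0 : r = kr KR.s1; · subst h0; simp
  by_cases h1 : r = kr KR.md; · subst h1; simp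
  by_cases h2 : r = kr KR.ex; · subst h2; simp
  by_cases h3 : r = kr KR.ju; · subst h3; simp
  by_cases h4 : r = kr KR.fl; · subst h4; simp
  by_cases h5 : r = kr KR.cnt; · subst h5; simp
  by_cases h6 : r = kr KR.s2; · subst h6; simp
  by_cases h7 : r = kr KR.cols; · subst h7; simp
  by_cases h8 : r = kr KR.pr; · subst h8; simp
  by_cases h9 : r = kr KR.ne; · subst h9; simp
  by_cases h10 : r = kr KR.fnd; · subst h10; simp
  by_cases h11 : r = kr KR.key; · subst h11; simp
  rw [xSt_other _ _ _ _ _ _ _ _ _ _ _ _ _ h0 h1 h2 h3 h4 h5 h6 h7 h8 h9 h10 h11]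

/-! ### Specification of the literal step -/

/-- Lookup in an occurrence table: presence. [folklore] -/
theorem recHas_ocRecs (F : List (List (ℕ × Bool))) (cap : ℕ) (zs : List ℕ) (u : ℕ) :
    recHas (ocRecs F cap zs) u = decide (u ∈ zs) := by
  unfold recHas ocRecs
  rw [List.any_map]
  by_cases h : u ∈ zs
  · rw [decide_eq_true h, List.any_eq_true]; exact ⟨u, h, by simp⟩
  · rw [decide_eq_false h, List.any_eq_false]; intro z hz; simp only [Function.comp_apply, beq_iff_eq]; rintro rfl; exact h hz

/-- Lookup in an occurrence table: payload. [folklore] -/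
theorem recPay_ocRecs (F : List (List (ℕ × Bool))) (cap : ℕ) (zs : List ℕ) (u : ℕ) :
    recPay (ocRecs F cap zs) u = if u ∈ zs then ocPay F cap u else [] := by
  unfold recPay ocRecs
  by_cases h : u ∈ zs
  · rw [if_pos h]
    cases hf : (zs.map fun z => (z, ocPay F cap z)).find? (fun r => r.1 == u) with
    | none =>
      exfalso
      rw [List.find?_eq_none] at hf
      exact hf (u, ocPay F cap u) (List.mem_map.2 ⟨u, h, rfl⟩) (by simp)
    | some r =>
      have := List.find?_some hf
      obtain ⟨z, -, rfl⟩ := List.mem_map.1 (List.mem_of_find?_eq_some hf)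
      simp only [beq_iff_eq] at this
      subst this; rfl
  · rw [if_neg h]
    cases hf : (zs.map fun z => (z, ocPay F cap z)).find? (fun r => r.1 == u) with
    | none => rfl
    | some r =>
      exfalso
      obtain ⟨z, hz, rfl⟩ := List.mem_map.1 (List.mem_of_find?_eq_some hf)
      have := List.find?_some hf
      simp only [beq_iff_eq] at this
      exact h (this ▸ hz)

/-- Payloads of an occurrence table are blank-free. [folklore] -/
theorem ocRecs_blank_free (F : List (List (ℕ × Bool))) (cap : ℕ) (zs : List ℕ) :
    ∀ r ∈ ocRecs F cap zs, Γ'.blank ∉ r.2 := by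
  intro r hr
  obtain ⟨z, -, rfl⟩ := List.mem_map.1 hr
  simp [ocPay]

/-- The effect of `useRec` on the candidate register. [folklore] -/
def useW (F : List (List (ℕ × Bool))) (cap : ℕ) (zs : List ℕ) (u : ℕ) (s2 : List Γ') : List Γ' :=
  if u ∈ zs ∧ occ F u ≤ cap then Γ'.comma :: (List.replicate (col F cap u) Γ'.ket ++ s2) else s2

/-- What the literal step needs of the base store. [folklore] -/
structure XBase (S : RStore) (F : List (List (ℕ × Bool))) (cap : ℕ) (zs : List ℕ) (x : ℕ) : Prop where
  /-- the saved probe -/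
  pr2 : S (kr KR.pr2) = rbits x
  /-- the occurrence table -/
  oc : S (kr KR.oc) = wRecs (ocRecs F cap zs)
  /-- scratch -/
  t1 : S (kr KR.t1) = []
  /-- scratch -/
  t2 : S (kr KR.t2) = []
  /-- scratch -/
  x2 : S (kr KR.x2) = []
  /-- scratch -/
  vw : S (kr KR.vw) = []
  /-- scratch -/
  eb : S (kr KR.eb) = []
  /-- scratch -/
  lmd : S (kr KR.lmd) = []
  /-- scratch -/
  dict2 : S (kr KR.dict2) = []

/-- **`useRec`** after the lookup of `u` in the occurrence table. [folklore] -/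
theorem runs_useRec (S : RStore) (F : List (List (ℕ × Bool))) (cap : ℕ) (zs : List ℕ) (u : ℕ) (s1 fl cnt s2 cols pr : List Γ') :
    Runs useRec (xSt S s1 [] [] [] fl cnt s2 cols pr [] (uflag (recHas (ocRecs F cap zs) u)) (recPay (ocRecs F cap zs) u))
      (xSt S s1 [] [] [] fl cnt (useW F cap zs u s2) cols pr [] [] []) (3 * (recPay (ocRecs F cap zs) u).length + 6) := by
  unfold useRec useW
  rw [recHas_ocRecs, recPay_ocRecs]
  by_cases hu : u ∈ zs
  · rw [decide_eq_true hu, if_pos hu]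
    refine Runs.pop_cons (k := kr KR.fnd) (a := Γ'.blank) (w := []) (by simp) ?_
    rw [update_xSt_fnd]
    unfold ocPay
    by_cases hl : occ F u ≤ cap
    · rw [decide_eq_true hl, if_pos ⟨hu, hl⟩]
      have h := runs_moveKets (xSt S s1 [] [] [] fl cnt s2 cols pr [] [] (List.replicate (col F cap u) Γ'.ket)) (col F cap u) (by simp)
      rw [xSt_s2, update_xSt_key, update_xSt_s2] at h
      refine (Runs.pop_cons (k := kr KR.key) (a := Γ'.bit true) (w := List.replicate (col F cap u) Γ'.ket) (by simp)
        (by rw [update_xSt_key]; exact h)).mono ?_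
      simp
    · rw [decide_eq_false hl, if_neg (fun h => hl h.2)]
      have h := runs_clear (kr KR.key) (xSt S s1 [] [] [] fl cnt s2 cols pr [] [] (List.replicate (col F cap u) Γ'.ket))
      rw [xSt_key, update_xSt_key] at h
      refine (Runs.pop_cons (k := kr KR.key) (a := Γ'.bit false) (w := List.replicate (col F cap u) Γ'.ket) (by simp)
        (by rw [update_xSt_key]; exact h)).mono ?_
      simp; omega
  · rw [decide_eq_false hu, if_neg hu, if_neg (fun h => hu h.1)]
    refine (Runs.pop_nil (by simp) ((Runs.skip _).of_eq (by simp) le_rfl)).mono (by omega)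

/-- **Specification of the literal step.** [folklore] -/
theorem runs_litEndX (S : RStore) (F : List (List (ℕ × Bool))) (cap : ℕ) (zs : List ℕ) (x : ℕ) (hX : XBase S F cap zs x) (u : ℕ)
    (s1 cnt s2 cols : List Γ') (f : Bool) :
    Runs litEndX (xSt S s1 [] (rbits u) (rbits u) (uflag f) cnt s2 cols (rbits x) [] [] [])
      (xSt S s1 [] [] [] (uflag (f || (u == x))) cnt (useW F cap zs u s2) cols (rbits x) [] [] [])
      ((12 * (rbits x).length + 2 * (rbits u).length + 12) + 6 + (2 * (rbits x).length + 1) + (10 * (rbits u).length + 3) +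
        (2 * (rbits u).length + 1) + ((12 * (rbits u).length + 44) * (wRecs (ocRecs F cap zs)).length + 4) +
        (3 * (wRecs (ocRecs F cap zs)).length + 6) + (2 * (rbits u).length + 1) + (10 * (rbits x).length + 3)) := by
  unfold litEndX
  -- 1. the comparison with `x`
  have hE := runs_eqW_map (tk := Γ'.blank) embEq_injective (xSt S s1 [] (rbits u) (rbits u) (uflag f) cnt s2 cols (rbits x) [] [] [])
    (u := rbits x) (v := rbits u) (by simp [embEq]) (by simp [embEq]) (by simp [embEq, hX.x2]) (by simp [embEq])
  have hfl : flagW Γ'.blank (rbits x ≠ rbits u) = flagW Γ'.blank (x ≠ u) := flagW_congr _ rbits_injective.ne_iff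
  have h1 : Runs ((eqW Γ'.blank).map embEq) (xSt S s1 [] (rbits u) (rbits u) (uflag f) cnt s2 cols (rbits x) [] [] [])
      (xSt S s1 [] [] (rbits u) (uflag f) cnt s2 cols (rbits x) (flagW Γ'.blank (x ≠ u)) [] []) (12 * (rbits x).length + 2 * (rbits u).length + 12) := by
    rw [hfl] at hE
    refine hE.of_eq ?_ le_rfl
    simp only [embEq]
    funext r
    by_cases h0 : r = kr KR.ne; · subst h0; simp
    rw [Function.update_of_ne h0]
    by_cases h1 : r = kr KR.x2; · subst h1; simp [hX.x2]
    rw [Function.update_of_ne h1]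
    by_cases h2 : r = kr KR.ex; · subst h2; simp
    rw [Function.update_of_ne h2]
    by_cases h3 : r = kr KR.pr; · subst h3; simp
    rw [Function.update_of_ne h3]
    simp [xSt, h0, h2, h3]
  -- 2. the flag
  have h2 : Runs (pop (kr KR.ne) fun o => match o with
      | some _ => skip
      | none => setFlagG Γ'.blank (kr KR.fl)) (xSt S s1 [] [] (rbits u) (uflag f) cnt s2 cols (rbits x) (flagW Γ'.blank (x ≠ u)) [] [])
      (xSt S s1 [] [] (rbits u) (uflag (f || (u == x))) cnt s2 cols (rbits x) [] [] []) 6 := by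
    by_cases hxu : x = u
    · subst hxu
      rw [flagW_false _ (by simp)]
      refine Runs.pop_nil (by simp) ?_
      dsimp only
      have h := runs_setFlagG Γ'.blank (kr KR.fl) (xSt S s1 [] [] (rbits x) (uflag f) cnt s2 cols (rbits x) [] [] []) (by cases f <;> simp)
      rw [update_xSt_fl] at h
      refine h.of_eq ?_ (by norm_num)
      simp
    · rw [flagW_true _ hxu]
      refine (Runs.pop_cons (k := kr KR.ne) (a := Γ'.blank) (w := []) (by simp) ((Runs.skip _).of_eq ?_ le_rfl)).mono (by norm_num)
      rw [update_xSt_ne]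
      have : (u == x) = false := beq_eq_false_iff_ne.2 (Ne.symm hxu)
      simp [this]
  set f' := (f || (u == x)) with hf'
  -- 3. the probe of `u`
  have h3 := runs_clear (kr KR.pr) (xSt S s1 [] [] (rbits u) (uflag f') cnt s2 cols (rbits x) [] [] [])
  rw [xSt_pr, update_xSt_pr] at h3
  have h4 := runs_copyToG (a := kr KR.ju) (b := kr KR.pr) (t₁ := kr KR.t1) (t₂ := kr KR.t2)
    (by simp) (by simp) (by simp) (by simp) (by simp) (by simp) (xSt S s1 [] [] (rbits u) (uflag f') cnt s2 cols [] [] [] [])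
    (by simp [hX.t1]) (by simp [hX.t2]) (by simp)
  rw [xSt_ju, update_xSt_pr] at h4
  have h5 := runs_clear (kr KR.ju) (xSt S s1 [] [] (rbits u) (uflag f') cnt s2 cols (rbits u) [] [] [])
  rw [xSt_ju, update_xSt_ju] at h5
  -- 4. the lookup
  have h6 := runs_findRec' (xSt S s1 [] [] [] (uflag f') cnt s2 cols (rbits u) [] [] []) u KR.oc (by decide) (by decide) (by decide)
    (by decide) (by decide) (by decide) (by decide) (by decide) (by decide) (by decide) (ocRecs F cap zs) (ocRecs_blank_free F cap zs)
    (by simp [hX.oc]) (by simp) (by simp [hX.x2]) (by simp [hX.t1]) (by simp [hX.t2]) (by simp [hX.dict2]) (by simp [hX.vw]) (by simp)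
    (by simp [hX.eb]) (by simp [hX.lmd]) (by simp) (by simp) (by simp)
  rw [update_xSt_fnd, update_xSt_key] at h6
  -- 5. use it
  have h7 := runs_useRec S F cap zs u s1 (uflag f') cnt s2 cols (rbits u)
  -- 6. restore the probe of `x`
  have h8 := runs_clear (kr KR.pr) (xSt S s1 [] [] [] (uflag f') cnt (useW F cap zs u s2) cols (rbits u) [] [] [])
  rw [xSt_pr, update_xSt_pr] at h8
  have h9 := runs_copyToG (a := kr KR.pr2) (b := kr KR.pr) (t₁ := kr KR.t1) (t₂ := kr KR.t2)
    (by simp) (by simp) (by simp) (by simp) (by simp) (by simp) (xSt S s1 [] [] [] (uflag f') cnt (useW F cap zs u s2) cols [] [] [] [])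
    (by simp [hX.t1]) (by simp [hX.t2]) (by simp)
  rw [xSt_pr2, hX.pr2, update_xSt_pr] at h9
  refine (h1.seq (h2.seq (h3.seq (h4.seq (h5.seq (h6.seq (h7.seq (h8.seq h9)))))))).mono ?_
  have hp : (recPay (ocRecs F cap zs) u).length ≤ (wRecs (ocRecs F cap zs)).length := by
    rw [recPay_ocRecs]
    split_ifs with h
    · unfold wRecs ocRecs
      obtain ⟨s₁, s₂, hs⟩ := List.append_of_mem h
      rw [hs]
      simp only [List.map_append, List.map_cons, List.flatMap_append, List.flatMap_cons, List.length_append, List.length_cons,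
        List.length_map]
      omega
    · simp
  omega

/-! ### Specification of the pass for a new variable -/

/-- The candidate register after the literals `lits`. [folklore] -/
def s2L (F : List (List (ℕ × Bool))) (cap : ℕ) (zs : List ℕ) (lits : List (ℕ × Bool)) (s2 : List Γ') : List Γ' :=
  lits.foldl (fun acc l => useW F cap zs l.1 acc) s2

/-- The colour register after the clauses `G`. [folklore] -/
def colsL (F : List (List (ℕ × Bool))) (cap : ℕ) (zs : List ℕ) (x : ℕ) (G : List (List (ℕ × Bool))) (cols : List Γ') : List Γ' :=
  G.foldl (fun acc c => if occursIn x c = true then (s2L F cap zs c []).reverse ++ acc else acc) cols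

/-- The cost of the literal step (`a`, `b` the token lengths of `x`, `u`; `Lo` the table length).
[folklore] -/
def litXCost (a b Lo : ℕ) : ℕ :=
  (12 * a + 2 * b + 12) + 6 + (2 * a + 1) + (10 * b + 3) + (2 * b + 1) + ((12 * b + 44) * Lo + 4) + (3 * Lo + 6) + (2 * b + 1) + (10 * a + 3)

/-- The per-symbol budget of the pass (`Lf` bounds the index tokens, `Lo` the table). [folklore] -/
def xK (Lf Lo : ℕ) : ℕ := (12 * Lf + 44) * Lo + 3 * Lo + 40 * Lf + 50

section XSpec

variable (S : RStore) (F : List (List (ℕ × Bool))) (cap : ℕ) (zs : List ℕ) (x : ℕ) (hX : XBase S F cap zs x)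
  (Lf : ℕ) (hxL : (rbits x).length ≤ Lf)
include hX hxL

omit hX hxL in
/-- Index bits go to `ex` and `ju` (mode `blank`). [folklore] -/
theorem segRuns_x_bits (fl cnt s2 cols pr : List Γ') : ∀ (u : List Bool) (rest ex ju : List Γ'),
    SegRuns (kr KR.s1) xBody (u.map Γ'.bit) (xSt S (u.map Γ'.bit ++ rest) [Γ'.blank] ex ju fl cnt s2 cols pr [] [] [])
      (xSt S rest [Γ'.blank] ((u.map Γ'.bit).reverse ++ ex) ((u.map Γ'.bit).reverse ++ ju) fl cnt s2 cols pr [] [] []) (7 * u.length)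
  | [], rest, ex, ju => by simpa using SegRuns.nil (kr KR.s1) xBody _
  | d :: u, rest, ex, ju => by
    have hbody : Runs (xBody (Γ'.bit d)) (Function.update (xSt S (Γ'.bit d :: (u.map Γ'.bit ++ rest)) [Γ'.blank] ex ju fl cnt s2 cols pr [] [] [])
        (kr KR.s1) (u.map Γ'.bit ++ rest)) (xSt S (u.map Γ'.bit ++ rest) [Γ'.blank] (Γ'.bit d :: ex) (Γ'.bit d :: ju) fl cnt s2 cols pr [] [] [])
        (3 + 2) := by
      rw [update_xSt_s1]; unfold xBody
      refine Runs.pop_cons (k := kr KR.md) (a := Γ'.blank) (w := []) (by simp) ?_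
      rw [update_xSt_md]
      refine ((Runs.push' (R' := xSt S (u.map Γ'.bit ++ rest) [] (Γ'.bit d :: ex) ju fl cnt s2 cols pr [] [] []) (by simp)).seq
        ((Runs.push' (R' := xSt S (u.map Γ'.bit ++ rest) [] (Γ'.bit d :: ex) (Γ'.bit d :: ju) fl cnt s2 cols pr [] [] []) (by simp)).seq
        (Runs.push' (by simp)))).of_eq rfl (by norm_num)
    have ih := segRuns_x_bits fl cnt s2 cols pr u rest (Γ'.bit d :: ex) (Γ'.bit d :: ju)
    have hk : xSt S (Γ'.bit d :: (u.map Γ'.bit ++ rest)) [Γ'.blank] ex ju fl cnt s2 cols pr [] [] [] (kr KR.s1) = Γ'.bit d :: (u.map Γ'.bit ++ rest) := by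
      simp
    refine (SegRuns.cons hk hbody ih).cast (by simp) (by simp) (by simp) ?_
    simp only [List.length_cons]; omega

/-- **One literal** `(u, q)`. [folklore] -/
theorem segRuns_x_literal (u : ℕ) (q : Bool) (huL : (rbits u).length ≤ Lf) (f : Bool) (cnt s2 cols rest : List Γ') :
    SegRuns (kr KR.s1) xBody (KCNF.encodeLiteral (u, q)) (xSt S (KCNF.encodeLiteral (u, q) ++ rest) [] [] [] (uflag f) cnt s2 cols (rbits x) [] [] [])
      (xSt S rest [] [] [] (uflag (f || (u == x))) cnt (useW F cap zs u s2) cols (rbits x) [] [] [])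
      (xK Lf (wRecs (ocRecs F cap zs)).length * (KCNF.encodeLiteral (u, q)).length) := by
  have hlit : KCNF.encodeLiteral (u, q) = Γ'.bit q :: ((encodeNat u).map Γ'.bit ++ [Γ'.comma]) := rfl
  rw [hlit]
  set bs := (encodeNat u).map Γ'.bit with hbs
  have hrb : bs.reverse = rbits u := rfl
  have h1 : Runs (xBody (Γ'.bit q)) (Function.update (xSt S (Γ'.bit q :: (bs ++ [Γ'.comma]) ++ rest) [] [] [] (uflag f) cnt s2 cols (rbits x) [] [] [])
      (kr KR.s1) (bs ++ [Γ'.comma] ++ rest)) (xSt S (bs ++ [Γ'.comma] ++ rest) [Γ'.blank] [] [] (uflag f) cnt s2 cols (rbits x) [] [] []) (1 + 2) := by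
    rw [update_xSt_s1]; unfold xBody
    exact Runs.pop_nil (by simp) (Runs.push' (by simp))
  have h2 := segRuns_x_bits S (uflag f) cnt s2 cols (rbits x) (encodeNat u) ([Γ'.comma] ++ rest) [] []
  rw [← hbs] at h2
  simp only [List.append_nil] at h2
  rw [hrb] at h2
  have h3 : Runs (xBody Γ'.comma) (Function.update (xSt S ([Γ'.comma] ++ rest) [Γ'.blank] (rbits u) (rbits u) (uflag f) cnt s2 cols (rbits x) [] [] [])
      (kr KR.s1) rest) (xSt S rest [] [] [] (uflag (f || (u == x))) cnt (useW F cap zs u s2) cols (rbits x) [] [] [])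
      (litXCost (rbits x).length (rbits u).length (wRecs (ocRecs F cap zs)).length + 2) := by
    rw [update_xSt_s1]; unfold xBody
    refine Runs.pop_cons (k := kr KR.md) (a := Γ'.blank) (w := []) (by simp) ?_
    rw [update_xSt_md]
    exact (runs_litEndX S F cap zs x hX u rest cnt s2 cols f).mono (le_of_eq rfl)
  have hk1 : xSt S (Γ'.bit q :: (bs ++ [Γ'.comma]) ++ rest) [] [] [] (uflag f) cnt s2 cols (rbits x) [] [] [] (kr KR.s1) =
      Γ'.bit q :: (bs ++ [Γ'.comma] ++ rest) := by simp
  have hk3 : xSt S ([Γ'.comma] ++ rest) [Γ'.blank] (rbits u) (rbits u) (uflag f) cnt s2 cols (rbits x) [] [] [] (kr KR.s1) = Γ'.comma :: rest := by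
    simp
  have h23 := h2.append (SegRuns.single hk3 h3)
  have := SegRuns.cons hk1 h1 (h23.cast rfl (by simp) rfl le_rfl)
  refine this.cast (by simp) rfl rfl ?_
  have hbl : bs.length = (rbits u).length := by simp [hbs, rbits]
  have hbl' : (encodeNat u).length = (rbits u).length := by simp [rbits]
  set Lo := (wRecs (ocRecs F cap zs)).length
  simp only [List.length_cons, List.length_append, List.length_nil, hbl', xK, litXCost]
  nlinarith [Nat.zero_le ((rbits u).length * Lo), Nat.zero_le (Lf * Lo), huL, hxL, Nat.zero_le Lo]

end XSpec

section XSpec2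

variable (S : RStore) (F : List (List (ℕ × Bool))) (cap : ℕ) (zs : List ℕ) (x : ℕ) (hX : XBase S F cap zs x)
  (Lf : ℕ) (hxL : (rbits x).length ≤ Lf)
include hX hxL

omit hX hxL in
/-- `s2L` over a cons. [folklore] -/
theorem s2L_cons (l : ℕ × Bool) (lits : List (ℕ × Bool)) (s2 : List Γ') :
    s2L F cap zs (l :: lits) s2 = s2L F cap zs lits (useW F cap zs l.1 s2) := rfl

/-- **The literals of a clause.** [folklore] -/
theorem segRuns_x_lits : ∀ (lits : List (ℕ × Bool)), (∀ l ∈ lits, (rbits l.1).length ≤ Lf) → ∀ (f : Bool) (cnt s2 cols rest : List Γ'),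
    SegRuns (kr KR.s1) xBody (cbody lits) (xSt S (cbody lits ++ rest) [] [] [] (uflag f) cnt s2 cols (rbits x) [] [] [])
      (xSt S rest [] [] [] (uflag (f || lits.any fun l => l.1 == x)) cnt (s2L F cap zs lits s2) cols (rbits x) [] [] [])
      (xK Lf (wRecs (ocRecs F cap zs)).length * (cbody lits).length)
  | [], _, f, cnt, s2, cols, rest => by simpa [s2L] using SegRuns.nil (kr KR.s1) xBody _
  | l :: lits, hl, f, cnt, s2, cols, rest => by
    have h1 := segRuns_x_literal S F cap zs x hX Lf hxL l.1 l.2 (hl l (by simp)) f cnt s2 cols (cbody lits ++ rest)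
    have h2 := segRuns_x_lits lits (fun l' h => hl l' (by simp [h])) (f || (l.1 == x)) cnt (useW F cap zs l.1 s2) cols rest
    have := h1.append h2
    refine this.cast (by simp [cbody_cons, encodeLiteral_eq]) (by simp [cbody_cons, encodeLiteral_eq]) ?_ ?_
    · simp [s2L_cons, Bool.or_assoc]
    · simp only [cbody_cons, encodeLiteral_eq, List.length_append, List.length_cons, List.length_nil]; ring_nf; omega

omit hX hxL in
/-- **`appendCand`.** [folklore] -/
theorem runs_appendCand : ∀ (s2 : List Γ') (R : RStore), R (kr KR.s2) = s2 →
    Runs appendCand R (Function.update (Function.update R (kr KR.s2) []) (kr KR.cols) (s2.reverse ++ R (kr KR.cols))) (3 * s2.length + 1)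
  | [], R, h => by
    refine (Runs.loop_nil _ h).of_eq ?_ (by simp)
    rw [List.reverse_nil, List.nil_append, Function.update_eq_self_iff.2 (by simp), Function.update_eq_self_iff.2 h.symm]
  | s :: s2, R, h => by
    have hb : Runs (push (kr KR.cols) s) (Function.update R (kr KR.s2) s2)
        (Function.update (Function.update R (kr KR.s2) s2) (kr KR.cols) (s :: R (kr KR.cols))) 1 := Runs.push' (by simp)
    have ih := runs_appendCand s2 (Function.update (Function.update R (kr KR.s2) s2) (kr KR.cols) (s :: R (kr KR.cols))) (by simp)
    unfold appendCand at ih ⊢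
    refine (Runs.loop_cons (f := fun s => push (kr KR.cols) s) h hb ih).of_eq ?_ (by simp; omega)
    simp only [Function.update_self]
    rw [Function.update_comm (by simp), Function.update_idem, Function.update_comm (by simp)]
    simp

omit hX hxL in
/-- **`clauseEndX`.** [folklore] -/
theorem runs_clauseEndX (h : Bool) (s1 cnt s2 cols pr : List Γ') :
    Runs clauseEndX (xSt S s1 [] [] [] (uflag h) cnt s2 cols pr [] [] [])
      (xSt S s1 [] [] [] [] (if h then Γ'.blank :: cnt else cnt) [] (if h then s2.reverse ++ cols else cols) pr [] [] []) (3 * s2.length + 5) := by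
  unfold clauseEndX
  cases h with
  | true =>
    refine (Runs.pop_cons (k := kr KR.fl) (a := Γ'.blank) (w := []) (by simp) ?_).mono (show (1 + (3 * s2.length + 1)) + 2 ≤ _ by omega)
    rw [update_xSt_fl]
    refine (Runs.push' (R' := xSt S s1 [] [] [] [] (Γ'.blank :: cnt) s2 cols pr [] [] []) (by simp)).seq ?_
    have ha := runs_appendCand s2 (xSt S s1 [] [] [] [] (Γ'.blank :: cnt) s2 cols pr [] [] []) (by simp)
    rw [update_xSt_s2, xSt_cols, update_xSt_cols] at ha
    simpa using ha
  | false =>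
    refine (Runs.pop_nil (by simp) ?_).mono (show (2 * s2.length + 1) + 2 ≤ _ by omega)
    have hc := runs_clear (kr KR.s2) (xSt S s1 [] [] [] (uflag false) cnt s2 cols pr [] [] [])
    rw [xSt_s2, update_xSt_s2] at hc
    simpa using hc

omit hX hxL in
/-- The candidate register grows by at most the table length per literal. [folklore] -/
theorem length_s2L_le : ∀ (lits : List (ℕ × Bool)) (s2 : List Γ'),
    (s2L F cap zs lits s2).length ≤ s2.length + (wRecs (ocRecs F cap zs)).length * lits.length
  | [], s2 => by simp [s2L]
  | l :: lits, s2 => by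
    rw [s2L_cons]
    refine (length_s2L_le lits _).trans ?_
    have : (useW F cap zs l.1 s2).length ≤ s2.length + (wRecs (ocRecs F cap zs)).length := by
      unfold useW
      split_ifs with h
      · obtain ⟨s₁, s₃, hs⟩ := List.append_of_mem h.1
        unfold wRecs ocRecs
        rw [hs]
        simp only [List.map_append, List.map_cons, List.flatMap_append, List.flatMap_cons, List.length_append, List.length_cons,
          List.length_replicate, ocPay]
        omega
      · omega
    simp only [List.length_cons]
    nlinarith

/-- The per-symbol budget of a clause. [folklore] -/
def cK (Lf Lo : ℕ) : ℕ := xK Lf Lo + 3 * Lo + 8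

/-- **One clause.** [folklore] -/
theorem segRuns_x_clause (c : List (ℕ × Bool)) (hc : ∀ l ∈ c, (rbits l.1).length ≤ Lf) (cnt cols rest : List Γ') :
    SegRuns (kr KR.s1) xBody (KCNF.encodeClause c) (xSt S (KCNF.encodeClause c ++ rest) [] [] [] [] cnt [] cols (rbits x) [] [] [])
      (xSt S rest [] [] [] [] (if occursIn x c then Γ'.blank :: cnt else cnt) []
        (if occursIn x c then (s2L F cap zs c []).reverse ++ cols else cols) (rbits x) [] [] [])
      (cK Lf (wRecs (ocRecs F cap zs)).length * (KCNF.encodeClause c).length) := by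
  have hw : KCNF.encodeClause c = Γ'.bra :: (cbody c ++ [Γ'.ket]) := by simp [KCNF.encodeClause, cbody]
  rw [hw]
  have h0 : Runs (xBody Γ'.bra) (Function.update (xSt S (Γ'.bra :: (cbody c ++ [Γ'.ket]) ++ rest) [] [] [] [] cnt [] cols (rbits x) [] [] [])
      (kr KR.s1) (cbody c ++ [Γ'.ket] ++ rest)) (xSt S (cbody c ++ [Γ'.ket] ++ rest) [] [] [] [] cnt [] cols (rbits x) [] [] []) (0 + 2) := by
    rw [update_xSt_s1]; unfold xBody
    exact Runs.pop_nil (by simp) ((Runs.skip _).of_eq (by simp) le_rfl)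
  have hk0 : xSt S (Γ'.bra :: (cbody c ++ [Γ'.ket]) ++ rest) [] [] [] [] cnt [] cols (rbits x) [] [] [] (kr KR.s1) =
      Γ'.bra :: (cbody c ++ [Γ'.ket] ++ rest) := by simp
  have h1 := segRuns_x_lits S F cap zs x hX Lf hxL c hc false cnt [] cols ([Γ'.ket] ++ rest)
  rw [show uflag false = [] from rfl, Bool.false_or] at h1
  have h2 : Runs (xBody Γ'.ket) (Function.update (xSt S ([Γ'.ket] ++ rest) [] [] [] (uflag (c.any fun l => l.1 == x)) cnt (s2L F cap zs c [])
      cols (rbits x) [] [] []) (kr KR.s1) rest)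
      (xSt S rest [] [] [] [] (if occursIn x c then Γ'.blank :: cnt else cnt) []
        (if occursIn x c then (s2L F cap zs c []).reverse ++ cols else cols) (rbits x) [] [] []) ((3 * (s2L F cap zs c []).length + 5) + 2) := by
    rw [update_xSt_s1]; unfold xBody
    refine Runs.pop_nil (by simp) ?_
    exact runs_clauseEndX S _ rest cnt _ cols (rbits x)
  have hk : xSt S ([Γ'.ket] ++ rest) [] [] [] (uflag (c.any fun l => l.1 == x)) cnt (s2L F cap zs c []) cols (rbits x) [] [] [] (kr KR.s1) =
      Γ'.ket :: rest := by simp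
  have := SegRuns.cons hk0 h0 ((h1.append (SegRuns.single hk h2)).cast rfl (by simp) rfl le_rfl)
  refine this.cast rfl rfl rfl ?_
  have hl := length_s2L_le F cap zs c []
  have hcl : c.length ≤ (cbody c).length := by
    unfold cbody; rw [List.length_flatMap]
    calc c.length = (c.map fun _ => 1).sum := by simp
      _ ≤ _ := List.sum_le_sum (fun l _ => by simp [encodeLiteral_eq])
  simp only [List.length_append, List.length_cons, List.length_nil, cK, Nat.zero_add] at hl ⊢
  have h3 : 3 * (s2L F cap zs c []).length ≤ 3 * (wRecs (ocRecs F cap zs)).length * (cbody c).length := by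
    calc 3 * (s2L F cap zs c []).length ≤ 3 * ((wRecs (ocRecs F cap zs)).length * c.length) := by omega
      _ ≤ 3 * ((wRecs (ocRecs F cap zs)).length * (cbody c).length) := by
          exact Nat.mul_le_mul_left _ (Nat.mul_le_mul_left _ hcl)
      _ = _ := by ring
  nlinarith [h3]

/-- **The clauses.** [folklore] -/
theorem segRuns_x_clauses : ∀ (G : List (List (ℕ × Bool))), (∀ c ∈ G, ∀ l ∈ c, (rbits l.1).length ≤ Lf) → ∀ (cnt cols rest : List Γ'),
    SegRuns (kr KR.s1) xBody (wFam G) (xSt S (wFam G ++ rest) [] [] [] [] cnt [] cols (rbits x) [] [] [])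
      (xSt S rest [] [] [] [] (ticks Γ'.blank (G.countP (occursIn x)) ++ cnt) [] (colsL F cap zs x G cols) (rbits x) [] [] [])
      (cK Lf (wRecs (ocRecs F cap zs)).length * (wFam G).length)
  | [], _, cnt, cols, rest => by simpa [wFam, colsL, ticks] using SegRuns.nil (kr KR.s1) xBody _
  | c :: G, hG, cnt, cols, rest => by
    have h1 := segRuns_x_clause S F cap zs x hX Lf hxL c (hG c (by simp)) cnt cols (wFam G ++ rest)
    have h2 := segRuns_x_clauses G (fun c' h => hG c' (by simp [h])) (if occursIn x c then Γ'.blank :: cnt else cnt)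
      (if occursIn x c then (s2L F cap zs c []).reverse ++ cols else cols) rest
    have := h1.append h2
    have hwc : wFam (c :: G) = KCNF.encodeClause c ++ wFam G := by rw [wFam_cons]; simp [KCNF.encodeClause, cbody]
    refine this.cast hwc.symm (by rw [hwc, List.append_assoc]) ?_ ?_
    · cases hoc : occursIn x c
      · simp [colsL, hoc]
      · simp [colsL, hoc, ticks, List.replicate_succ']
    · rw [hwc, List.length_append]; ring_nf; omega

/-- **Specification of `xPass`.** [folklore] -/
theorem runs_xPass (hfam : S (kr KR.fam) = wFam F) (hF : ∀ c ∈ F, ∀ l ∈ c, (rbits l.1).length ≤ Lf) :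
    Runs xPass (xSt S [] [] [] [] [] [] [] [] (rbits x) [] [] [])
      (xSt S [] [] [] [] [] (ticks Γ'.blank (occ F x)) [] (colsL F cap zs x F []) (rbits x) [] [] [])
      ((cK Lf (wRecs (ocRecs F cap zs)).length + 10) * (wFam F).length + 4) := by
  unfold xPass
  have h0 := runs_copyToG (a := kr KR.fam) (b := kr KR.s1) (t₁ := kr KR.t1) (t₂ := kr KR.t2)
    (by simp) (by simp) (by simp) (by simp) (by simp) (by simp) (xSt S [] [] [] [] [] [] [] [] (rbits x) [] [] [])
    (by simp [hX.t1]) (by simp [hX.t2]) (by simp)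
  rw [xSt_fam, hfam, update_xSt_s1] at h0
  have h1 := (segRuns_x_clauses S F cap zs x hX Lf hxL F hF [] [] []).runs_loop_nil (by simp)
  simp only [List.append_nil] at h1
  refine (h0.seq h1).of_eq (by rw [occ]) (by nlinarith)

end XSpec2

/-! ### The colour register is a colour list; the machine's colour is `col` -/

/-- `candOf` over a cons. [folklore] -/
theorem candOf_cons (F : List (List (ℕ × Bool))) (cap : ℕ) (zs : List ℕ) (l : ℕ × Bool) (c : List (ℕ × Bool)) :
    candOf F cap zs (l :: c) = (if l.1 ∈ zs ∧ occ F l.1 ≤ cap then [col F cap l.1] else []) ++ candOf F cap zs c := by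
  unfold candOf; rw [List.filterMap_cons]; split_ifs <;> simp

/-- `wCols` is a homomorphism. [folklore] -/
theorem wCols_append (L₁ L₂ : List ℕ) : wCols (L₁ ++ L₂) = wCols L₁ ++ wCols L₂ := by simp [wCols]

/-- The candidate register reversed is the colour word of the candidates. [folklore] -/
theorem s2L_reverse (F : List (List (ℕ × Bool))) (cap : ℕ) (zs : List ℕ) : ∀ (lits : List (ℕ × Bool)) (s2 : List Γ'),
    (s2L F cap zs lits s2).reverse = s2.reverse ++ wCols (candOf F cap zs lits)
  | [], s2 => by simp [s2L, candOf, wCols]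
  | l :: lits, s2 => by
    rw [s2L_cons, s2L_reverse F cap zs lits, candOf_cons, wCols_append]
    unfold useW
    split_ifs with h <;> simp [wCols]

/-- The colour register is the colour word of the forbidden colours. [folklore] -/
theorem colsL_eq (F : List (List (ℕ × Bool))) (cap : ℕ) (zs : List ℕ) (x : ℕ) : ∀ (G : List (List (ℕ × Bool))) (cols : List Γ'),
    colsL F cap zs x G cols = wCols (forbW F cap zs x G) ++ cols
  | [], cols => by simp [colsL, forbW, wCols]
  | c :: G, cols => by
    have ih := colsL_eq F cap zs x G
    unfold colsL at ih ⊢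
    rw [List.foldl_cons, ih]
    unfold forbW
    rw [List.filter_cons]
    cases occursIn x c <;> simp [wCols_append, s2L_reverse, List.flatMap_append]

/-- `freshNat` depends only on membership. [folklore] -/
theorem freshNat_congr {l₁ l₂ : List ℕ} (h : ∀ m, m ∈ l₁ ↔ m ∈ l₂) : freshNat l₁ = freshNat l₂ := by
  rcases lt_trichotomy (freshNat l₁) (freshNat l₂) with hlt | heq | hgt
  · exact absurd ((h _).2 (mem_of_lt_freshNat hlt)) (freshNat_not_mem l₁)
  · exact heq
  · exact absurd ((h _).1 (mem_of_lt_freshNat hgt)) (freshNat_not_mem l₂)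

/-- Membership in the forbidden colours. [folklore] -/
theorem mem_forbW (F : List (List (ℕ × Bool))) (cap : ℕ) (zs : List ℕ) (x m : ℕ) (G : List (List (ℕ × Bool))) :
    m ∈ forbW F cap zs x G ↔ ∃ c ∈ G, occursIn x c = true ∧ ∃ l ∈ c, l.1 ∈ zs ∧ occ F l.1 ≤ cap ∧ col F cap l.1 = m := by
  unfold forbW candOf
  simp only [List.mem_flatMap, List.mem_reverse, List.mem_filter, List.mem_filterMap, Option.ite_none_right_eq_some,
    Option.some.injEq]
  constructor
  · rintro ⟨c, ⟨hc, hx⟩, l, hl, hcond, rfl⟩; exact ⟨c, hc, hx, l, hl, hcond.1, hcond.2, rfl⟩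
  · rintro ⟨c, hc, hx, l, hl, h1, h2, rfl⟩; exact ⟨c, ⟨hc, hx⟩, l, hl, ⟨h1, h2⟩, rfl⟩

/-- **The machine's colour is the greedy colour**, provided the table holds exactly the earlier
variables. [folklore] -/
theorem col_eq_freshNat_forbW (F : List (List (ℕ × Bool))) (cap : ℕ) (zs : List ℕ) (x : ℕ) (hzs : ∀ z, z ∈ zs ↔ z ∈ pre F x) :
    col F cap x = freshNat (forbW F cap zs x F) := by
  obtain ⟨L, hL, hmem⟩ := col_spec F cap x
  rw [hL]
  refine freshNat_congr fun m => ?_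
  rw [hmem, mem_forbW]
  constructor
  · rintro ⟨z, hz, h1, h2, rfl⟩
    unfold cooccur at h2
    obtain ⟨c, hc, h⟩ := List.any_eq_true.1 h2
    simp only [Bool.and_eq_true] at h
    obtain ⟨l, hl, hlz⟩ := occursIn_eq_true.1 h.2
    exact ⟨c, hc, h.1, l, hl, by rw [hlz]; exact (hzs z).2 hz, by rw [hlz]; exact h1, by rw [hlz]⟩
  · rintro ⟨c, hc, hx, l, hl, h1, h2, rfl⟩
    refine ⟨l.1, (hzs _).1 h1, h2, ?_, rfl⟩
    unfold cooccur
    exact List.any_eq_true.2 ⟨c, hc, by simp [hx, occursIn_eq_true.2 ⟨l, hl, rfl⟩]⟩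

/-! ### Appending the record of a new variable to the occurrence table -/

/-- Move all symbols of `a` onto `b` (reversing them). [folklore] -/
theorem runs_moveAll {a b : Reg} (hab : a ≠ b) : ∀ (u : List Γ') (R : RStore), R a = u →
    Runs (loop a fun s => push b s) R (Function.update (Function.update R a []) b (u.reverse ++ R b)) (3 * u.length + 1)
  | [], R, h => by
    refine (Runs.loop_nil _ h).of_eq ?_ (by simp)
    rw [List.reverse_nil, List.nil_append, Function.update_eq_self_iff.2 (by simp [hab.symm]), Function.update_eq_self_iff.2 h.symm]
  | s :: u, R, h => by
    have hb : Runs (push b s) (Function.update R a u) (Function.update (Function.update R a u) b (s :: R b)) 1 :=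
      Runs.push' (by simp [hab.symm])
    have ih := runs_moveAll hab u (Function.update (Function.update R a u) b (s :: R b)) (by simp [hab])
    refine (Runs.loop_cons (f := fun s => push b s) h hb ih).of_eq ?_ (by simp; omega)
    funext q
    by_cases q1 : q = b; · subst q1; simp
    by_cases q2 : q = a; · subst q2; simp [hab]
    simp [q1, q2]

/-- Push one ket onto `b` for every symbol of `a`. [folklore] -/
theorem runs_pushKets {a b : Reg} (hab : a ≠ b) : ∀ (n : ℕ) (R : RStore), R a = List.replicate n Γ'.ket →
    Runs (loop a fun _ => push b Γ'.ket) R (Function.update (Function.update R a []) b (List.replicate n Γ'.ket ++ R b)) (3 * n + 1)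
  | 0, R, h => by
    refine (Runs.loop_nil _ h).of_eq ?_ (by simp)
    rw [List.replicate_zero, List.nil_append, Function.update_eq_self_iff.2 (by simp [hab.symm]), Function.update_eq_self_iff.2 h.symm]
  | n + 1, R, h => by
    rw [List.replicate_succ] at h
    have hb : Runs (push b Γ'.ket) (Function.update R a (List.replicate n Γ'.ket))
        (Function.update (Function.update R a (List.replicate n Γ'.ket)) b (Γ'.ket :: R b)) 1 := Runs.push' (by simp [hab.symm])
    have ih := runs_pushKets hab n (Function.update (Function.update R a (List.replicate n Γ'.ket)) b (Γ'.ket :: R b)) (by simp [hab])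
    refine (Runs.loop_cons (f := fun _ => push b Γ'.ket) h hb ih).of_eq ?_ (by omega)
    funext q
    by_cases q1 : q = b; · subst q1; simp [List.replicate_succ']
    by_cases q2 : q = a; · subst q2; simp [hab]
    simp [q1, q2]

/-- `buildRec`: append to the occurrence table the record of `x` (index token reversed in `pr`,
light flag in `fl`, colour kets in `c`), consuming the three. [folklore] -/
def buildRec : RProg :=
  pour (kr KR.oc) (kr KR.t1) ;; pour (kr KR.pr) (kr KR.t2) ;; loop (kr KR.t2) (fun s => push (kr KR.t1) s) ;;
  push (kr KR.t1) Γ'.comma ;;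
  (pop (kr KR.fl) fun o => match o with
    | some _ => push (kr KR.t1) (Γ'.bit true)
    | none => push (kr KR.t1) (Γ'.bit false)) ;;
  loop (kr KR.c) (fun _ => push (kr KR.t1) Γ'.ket) ;; push (kr KR.t1) Γ'.blank ;; pour (kr KR.t1) (kr KR.oc)

/-- **Specification of `buildRec`.** [folklore] -/
theorem runs_buildRec (R : RStore) (ocw : List Γ') (x : ℕ) (lt : Bool) (cc : ℕ) (hoc : R (kr KR.oc) = ocw) (hpr : R (kr KR.pr) = rbits x)
    (hfl : R (kr KR.fl) = uflag lt) (hc : R (kr KR.c) = List.replicate cc Γ'.ket) (ht1 : R (kr KR.t1) = []) (ht2 : R (kr KR.t2) = []) :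
    Runs buildRec R (Function.update (Function.update (Function.update (Function.update R (kr KR.pr) []) (kr KR.fl) []) (kr KR.c) [])
      (kr KR.oc) (ocw ++ ((encodeNat x).map Γ'.bit ++ Γ'.comma :: (Γ'.bit lt :: List.replicate cc Γ'.ket ++ [Γ'.blank]))))
      (6 * ocw.length + 9 * (rbits x).length + 6 * cc + 20) := by
  unfold buildRec
  set rec := (encodeNat x).map Γ'.bit ++ Γ'.comma :: (Γ'.bit lt :: List.replicate cc Γ'.ket ++ [Γ'.blank]) with hrec
  -- 1. table to t1 (reversed)
  have h1 := runs_pour (a := kr KR.oc) (b := kr KR.t1) (by simp) R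
  rw [hoc, ht1, List.append_nil] at h1
  set R1 := Function.update (Function.update R (kr KR.oc) []) (kr KR.t1) ocw.reverse with hR1
  -- 2. probe to t2 (reading order)
  have h2 := runs_pour (a := kr KR.pr) (b := kr KR.t2) (by simp) R1
  have e2a : R1 (kr KR.pr) = rbits x := by simp [hR1, hpr]
  have e2b : R1 (kr KR.t2) = [] := by simp [hR1, ht2]
  rw [e2a, e2b, List.append_nil] at h2
  have erb : (rbits x).reverse = (encodeNat x).map Γ'.bit := by simp [rbits]
  rw [erb] at h2
  set R2 := Function.update (Function.update R1 (kr KR.pr) []) (kr KR.t2) ((encodeNat x).map Γ'.bit) with hR2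
  -- 3. bits onto t1
  have h3 := runs_moveAll (a := kr KR.t2) (b := kr KR.t1) (by simp) ((encodeNat x).map Γ'.bit) R2 (by simp [hR2])
  have e3 : R2 (kr KR.t1) = ocw.reverse := by simp [hR2, hR1]
  rw [e3] at h3
  set R3 := Function.update (Function.update R2 (kr KR.t2) []) (kr KR.t1) (((encodeNat x).map Γ'.bit).reverse ++ ocw.reverse) with hR3
  -- 4. comma
  have h4 : Runs (push (kr KR.t1) Γ'.comma) R3 (Function.update R3 (kr KR.t1) (Γ'.comma :: (((encodeNat x).map Γ'.bit).reverse ++ ocw.reverse))) 1 :=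
    Runs.push' (by simp [hR3])
  set R4 := Function.update R3 (kr KR.t1) (Γ'.comma :: (((encodeNat x).map Γ'.bit).reverse ++ ocw.reverse)) with hR4
  -- 5. light flag
  have h5 : Runs (pop (kr KR.fl) fun o => match o with
      | some _ => push (kr KR.t1) (Γ'.bit true)
      | none => push (kr KR.t1) (Γ'.bit false)) R4
      (Function.update (Function.update R4 (kr KR.fl) []) (kr KR.t1) (Γ'.bit lt :: Γ'.comma :: (((encodeNat x).map Γ'.bit).reverse ++ ocw.reverse))) 3 := by
    have efl : R4 (kr KR.fl) = uflag lt := by simp [hR4, hR3, hR2, hR1, hfl]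
    cases lt with
    | true => exact Runs.pop_cons (k := kr KR.fl) (a := Γ'.blank) (w := []) efl (Runs.push' (by simp [hR4]))
    | false =>
      have e : Function.update R4 (kr KR.fl) [] = R4 := Function.update_eq_self_iff.2 efl.symm
      refine (Runs.pop_nil efl (Runs.push' ?_)).mono (by norm_num)
      rw [e]; simp [hR4]
  set R5 := Function.update (Function.update R4 (kr KR.fl) []) (kr KR.t1) (Γ'.bit lt :: Γ'.comma :: (((encodeNat x).map Γ'.bit).reverse ++ ocw.reverse))
    with hR5
  -- 6. colour kets
  have h6 := runs_pushKets (a := kr KR.c) (b := kr KR.t1) (by simp) cc R5 (by simp [hR5, hR4, hR3, hR2, hR1, hc])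
  have e6 : R5 (kr KR.t1) = Γ'.bit lt :: Γ'.comma :: (((encodeNat x).map Γ'.bit).reverse ++ ocw.reverse) := by simp [hR5]
  rw [e6] at h6
  set R6 := Function.update (Function.update R5 (kr KR.c) []) (kr KR.t1)
    (List.replicate cc Γ'.ket ++ Γ'.bit lt :: Γ'.comma :: (((encodeNat x).map Γ'.bit).reverse ++ ocw.reverse)) with hR6
  -- 7. blank, 8. back to the table
  have h7 : Runs (push (kr KR.t1) Γ'.blank) R6 (Function.update R6 (kr KR.t1) (ocw ++ rec).reverse) 1 := by
    refine Runs.push' ?_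
    congr 1
    simp [hR6, hrec, List.reverse_append]
  have h8 := runs_pour (a := kr KR.t1) (b := kr KR.oc) (by simp) (Function.update R6 (kr KR.t1) (ocw ++ rec).reverse)
  have e8 : Function.update R6 (kr KR.t1) (ocw ++ rec).reverse (kr KR.oc) = [] := by simp [hR6, hR5, hR4, hR3, hR2, hR1]
  rw [Function.update_self, e8, List.reverse_reverse, List.append_nil, List.length_reverse] at h8
  refine (h1.seq (h2.seq (h3.seq (h4.seq (h5.seq (h6.seq (h7.seq h8))))))).of_eq ?_ ?_
  · simp only [hR6, hR5, hR4, hR3, hR2, hR1, Function.update_idem]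
    funext q
    by_cases q1 : q = kr KR.oc; · subst q1; simp
    by_cases q2 : q = kr KR.t1; · subst q2; simp [ht1]
    by_cases q3 : q = kr KR.c; · subst q3; simp
    by_cases q4 : q = kr KR.fl; · subst q4; simp
    by_cases q5 : q = kr KR.t2; · subst q5; simp [ht2]
    by_cases q6 : q = kr KR.pr; · subst q6; simp
    simp [q1, q2, q3, q4, q5, q6]
  · have : rec.length = (rbits x).length + cc + 3 := by simp [hrec, rbits]; omega
    simp only [List.length_append, List.length_map, this]
    have : (encodeNat x).length = (rbits x).length := by simp [rbits]
    omega

/-! ### A new variable: count, colour, record -/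

/-- `newVar cap`: for the new variable `x` (probe in `pr`), run the pass over the clauses, decide
lightness, find the least free colour, append the record to the occurrence table; clean up
(the probe is consumed). [folklore] -/
def newVar (cap : ℕ) : RProg :=
  copyToG (kr KR.pr) (kr KR.pr2) (kr KR.t1) (kr KR.t2) ;; xPass ;; leCap cap ;; clear (kr KR.cnt) ;; freshCol ;; buildRec ;;
  clear (kr KR.cols) ;; clear (kr KR.pr2)

/-- What `newVar` needs of the store: the clauses, the table of the earlier variables, and all its
scratch registers empty. [folklore] -/
structure NvBase (S : RStore) (F : List (List (ℕ × Bool))) (cap : ℕ) (zs : List ℕ) : Prop where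
  /-- the clauses -/
  fam : S (kr KR.fam) = wFam F
  /-- the occurrence table so far -/
  oc : S (kr KR.oc) = wRecs (ocRecs F cap zs)
  /-- scratch -/
  pr2 : S (kr KR.pr2) = []
  /-- scratch -/
  t1 : S (kr KR.t1) = []
  /-- scratch -/
  t2 : S (kr KR.t2) = []
  /-- scratch -/
  x2 : S (kr KR.x2) = []
  /-- scratch -/
  vw : S (kr KR.vw) = []
  /-- scratch -/
  eb : S (kr KR.eb) = []
  /-- scratch -/
  lmd : S (kr KR.lmd) = []
  /-- scratch -/
  dict2 : S (kr KR.dict2) = []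
  /-- scratch -/
  s1 : S (kr KR.s1) = []
  /-- scratch -/
  md : S (kr KR.md) = []
  /-- scratch -/
  ex : S (kr KR.ex) = []
  /-- scratch -/
  ju : S (kr KR.ju) = []
  /-- scratch -/
  fl : S (kr KR.fl) = []
  /-- scratch -/
  cnt : S (kr KR.cnt) = []
  /-- scratch -/
  s2 : S (kr KR.s2) = []
  /-- scratch -/
  cols : S (kr KR.cols) = []
  /-- scratch -/
  ne : S (kr KR.ne) = []
  /-- scratch -/
  fnd : S (kr KR.fnd) = []
  /-- scratch -/
  key : S (kr KR.key) = []
  /-- scratch -/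
  c : S (kr KR.c) = []
  /-- scratch -/
  u2 : S (kr KR.u2) = []
  /-- scratch -/
  u3 : S (kr KR.u3) = []
  /-- scratch -/
  s3 : S (kr KR.s3) = []
  /-- scratch -/
  s4 : S (kr KR.s4) = []
  /-- scratch -/
  s5 : S (kr KR.s5) = []
  /-- scratch -/
  fl2 : S (kr KR.fl2) = []
  /-- scratch -/
  fl3 : S (kr KR.fl3) = []

/-- The colour register is at most table length times clause-list length. [folklore] -/
theorem length_colsL_le (F : List (List (ℕ × Bool))) (cap : ℕ) (zs : List ℕ) (x : ℕ) : ∀ (G : List (List (ℕ × Bool))) (cols : List Γ'),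
    (colsL F cap zs x G cols).length ≤ cols.length + (wRecs (ocRecs F cap zs)).length * (wFam G).length
  | [], cols => by simp [colsL]
  | c :: G, cols => by
    unfold colsL
    rw [List.foldl_cons]
    refine (length_colsL_le F cap zs x G _).trans ?_
    have hs := length_s2L_le F cap zs c []
    have hcl : c.length ≤ (cbody c).length + 2 := by
      unfold cbody; rw [List.length_flatMap]
      calc c.length = (c.map fun _ => 1).sum := by simp
        _ ≤ (c.map fun l => (KCNF.encodeLiteral l).length).sum := List.sum_le_sum (fun l _ => by simp [encodeLiteral_eq])
        _ ≤ _ := Nat.le_add_right _ _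
    rw [wFam_cons]
    simp only [List.length_append, List.length_cons]
    have hm := Nat.mul_le_mul_left (wRecs (ocRecs F cap zs)).length hcl
    split_ifs
    · simp only [List.length_append, List.length_reverse, List.length_nil, Nat.zero_add] at hs ⊢
      nlinarith
    · nlinarith

/-- `freshNat` is at most the length of the colour word. [folklore] -/
theorem freshNat_le_length_wCols (L : List ℕ) : freshNat L ≤ (wCols L).length := by
  refine (freshNat_le_card L).trans ((List.toFinset_card_le L).trans ?_)
  unfold wCols; rw [List.length_flatMap]
  calc L.length = (L.map fun _ => 1).sum := by simp
    _ ≤ _ := List.sum_le_sum (fun c _ => by simp)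

/-- The cost of `newVar` in terms of the token bound `Lf`, the table length `Lo`, the clause-list
length `Wf` and `cap`. [folklore] -/
def nvCost (Lf Lo Wf cap : ℕ) : ℕ :=
  (10 * Lf + 3) + ((cK Lf Lo + 10) * Wf + 4) + (2 * cap + 3) + (2 * Wf + 1) +
    (((12 * (Lo * Wf) + 47) * (Lo * Wf) + 10 + 2) * (Lo * Wf + 1) + 1 + 1) + (6 * Lo + 9 * Lf + 6 * (Lo * Wf) + 20) +
    (2 * (Lo * Wf) + 1) + (2 * Lf + 1)

/-- `wRecs` is a homomorphism. [folklore] -/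
theorem wRecs_append (r₁ r₂ : List (ℕ × List Γ')) : wRecs (r₁ ++ r₂) = wRecs r₁ ++ wRecs r₂ := by simp [wRecs]

/-- **Specification of `newVar`.** With the table of exactly the earlier variables of `x`, the
record of `x` — light flag `occ F x ≤ cap` and colour `col F cap x` — is appended. [folklore] -/
theorem runs_newVar (S : RStore) (F : List (List (ℕ × Bool))) (cap : ℕ) (zs : List ℕ) (hN : NvBase S F cap zs) (x : ℕ)
    (hpr : S (kr KR.pr) = rbits x) (hzs : ∀ z, z ∈ zs ↔ z ∈ pre F x) (Lf : ℕ) (hxL : (rbits x).length ≤ Lf)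
    (hF : ∀ c ∈ F, ∀ l ∈ c, (rbits l.1).length ≤ Lf) :
    Runs (newVar cap) S (Function.update (Function.update S (kr KR.pr) []) (kr KR.oc) (wRecs (ocRecs F cap (zs ++ [x]))))
      (nvCost Lf (wRecs (ocRecs F cap zs)).length (wFam F).length cap) := by
  set Lo := (wRecs (ocRecs F cap zs)).length with hLo
  set Wf := (wFam F).length with hWf
  set forb := forbW F cap zs x F with hforb
  have hWc : (wCols forb).length ≤ Lo * Wf := by
    have := length_colsL_le F cap zs x F []
    rw [colsL_eq] at this; simpa using this
  have hfN : freshNat forb ≤ Lo * Wf := (freshNat_le_length_wCols forb).trans hWc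
  have hcol : col F cap x = freshNat forb := col_eq_freshNat_forbW F cap zs x hzs
  have hocc : occ F x ≤ Wf := by
    rw [hWf, occ]; refine (List.countP_le_length).trans ?_
    unfold wFam; rw [List.length_flatMap]
    calc F.length = (F.map fun _ => 1).sum := by simp
      _ ≤ _ := List.sum_le_sum (fun c _ => by simp [KCNF.encodeClause])
  unfold newVar
  -- 1. save the probe
  have h1 := runs_copyToG (a := kr KR.pr) (b := kr KR.pr2) (t₁ := kr KR.t1) (t₂ := kr KR.t2)
    (by simp) (by simp) (by simp) (by simp) (by simp) (by simp) S hN.t1 hN.t2 hN.pr2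
  rw [hpr] at h1
  set S1 := Function.update S (kr KR.pr2) (rbits x) with hS1
  -- 2. the pass
  have hX : XBase S1 F cap zs x :=
    { pr2 := by simp [hS1], oc := by simp [hS1, hN.oc], t1 := by simp [hS1, hN.t1], t2 := by simp [hS1, hN.t2], x2 := by simp [hS1, hN.x2],
      vw := by simp [hS1, hN.vw], eb := by simp [hS1, hN.eb], lmd := by simp [hS1, hN.lmd], dict2 := by simp [hS1, hN.dict2] }
  have e1 : xSt S1 [] [] [] [] [] [] [] [] (rbits x) [] [] [] = S1 := by
    have e := xSt_eta S1
    simp only [hS1, ne_eq, reduceCtorEq, not_false_eq_true, Function.update_of_ne, Sum.inr.injEq, hN.s1, hN.md, hN.ex, hN.ju, hN.fl,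
      hN.cnt, hN.s2, hN.cols, hpr, hN.ne, hN.fnd, hN.key] at e ⊢
    exact e
  have h2 := runs_xPass S1 F cap zs x hX Lf hxL (by simp [hS1, hN.fam]) hF
  rw [e1, colsL_eq, List.append_nil, ← hforb] at h2
  set S2 := xSt S1 [] [] [] [] [] (ticks Γ'.blank (occ F x)) [] (wCols forb) (rbits x) [] [] [] with hS2
  -- 3. lightness
  have h3 := runs_leCap cap S2 (by simp [hS2]) (occ F x) (by simp [hS2])
  set S3 := Function.update (Function.update S2 (kr KR.cnt) (ticks Γ'.blank (occ F x - (cap + 1)))) (kr KR.fl) (uflag (decide (occ F x ≤ cap)))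
    with hS3
  have h4 := runs_clear (kr KR.cnt) S3
  have e4 : S3 (kr KR.cnt) = ticks Γ'.blank (occ F x - (cap + 1)) := by simp [hS3]
  rw [e4, length_ticks] at h4
  set S4 := Function.update S3 (kr KR.cnt) [] with hS4
  -- 4. the least free colour
  have rd4 : ∀ r : KR, r ≠ KR.cnt → r ≠ KR.fl → r ≠ KR.cols → r ≠ KR.pr2 → r ≠ KR.s1 → r ≠ KR.md → r ≠ KR.ex → r ≠ KR.ju → r ≠ KR.s2 →
      r ≠ KR.pr → r ≠ KR.ne → r ≠ KR.fnd → r ≠ KR.key → S4 (kr r) = S (kr r) := by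
    intro r h1 h2 h3 h4 h5 h6 h7 h8 h9 h10 h11 h12 h13
    simp only [hS4, hS3, hS2, hS1]
    rw [Function.update_of_ne (by simp [h1]), Function.update_of_ne (by simp [h2]), Function.update_of_ne (by simp [h1]),
      xSt_other _ _ _ _ _ _ _ _ _ _ _ _ _ (by simp [h5]) (by simp [h6]) (by simp [h7]) (by simp [h8]) (by simp [h2]) (by simp [h1]) (by simp [h9])
        (by simp [h3]) (by simp [h10]) (by simp [h11]) (by simp [h12]) (by simp [h13]),
      Function.update_of_ne (by simp [h4])]
  have h5 := runs_freshCol S4 forb (by simp [hS4, hS3, hS2]) (by rw [rd4 KR.c] <;> first | exact hN.c | decide)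
    (by rw [rd4 KR.t1] <;> first | exact hN.t1 | decide) (by rw [rd4 KR.t2] <;> first | exact hN.t2 | decide)
    (by rw [rd4 KR.u2] <;> first | exact hN.u2 | decide) (by rw [rd4 KR.s3] <;> first | exact hN.s3 | decide)
    (by rw [rd4 KR.s4] <;> first | exact hN.s4 | decide) (by rw [rd4 KR.s5] <;> first | exact hN.s5 | decide)
    (by rw [rd4 KR.fl2] <;> first | exact hN.fl2 | decide) (by rw [rd4 KR.fl3] <;> first | exact hN.fl3 | decide)
    (by rw [rd4 KR.u3] <;> first | exact hN.u3 | decide)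
  set S5 := Function.update S4 (kr KR.c) (List.replicate (freshNat forb) Γ'.ket) with hS5
  -- 5. the record
  have h6 := runs_buildRec S5 (wRecs (ocRecs F cap zs)) x (decide (occ F x ≤ cap)) (freshNat forb)
    (by rw [hS5, Function.update_of_ne (by simp), rd4 KR.oc] <;> first | exact hN.oc | decide) (by simp [hS5, hS4, hS3, hS2])
    (by simp [hS5, hS4, hS3]) (by simp [hS5]) (by rw [hS5, Function.update_of_ne (by simp), rd4 KR.t1] <;> first | exact hN.t1 | decide)
    (by rw [hS5, Function.update_of_ne (by simp), rd4 KR.t2] <;> first | exact hN.t2 | decide)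
  set S6 := Function.update (Function.update (Function.update (Function.update S5 (kr KR.pr) []) (kr KR.fl) []) (kr KR.c) []) (kr KR.oc)
    (wRecs (ocRecs F cap zs) ++ ((encodeNat x).map Γ'.bit ++ Γ'.comma :: (Γ'.bit (decide (occ F x ≤ cap)) ::
      List.replicate (freshNat forb) Γ'.ket ++ [Γ'.blank]))) with hS6
  -- 6. cleanup
  have h7 := runs_clear (kr KR.cols) S6
  have e7 : S6 (kr KR.cols) = wCols forb := by simp [hS6, hS5, hS4, hS3, hS2]
  rw [e7] at h7
  set S7 := Function.update S6 (kr KR.cols) [] with hS7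
  have h8 := runs_clear (kr KR.pr2) S7
  have e8 : S7 (kr KR.pr2) = rbits x := by simp [hS7, hS6, hS5, hS4, hS3, hS2, hS1]
  rw [e8] at h8
  refine (h1.seq (h2.seq (h3.seq (h4.seq (h5.seq (h6.seq (h7.seq h8))))))).of_eq ?_ ?_
  · -- the final store
    have hrec : wRecs (ocRecs F cap (zs ++ [x])) = wRecs (ocRecs F cap zs) ++ ((encodeNat x).map Γ'.bit ++ Γ'.comma ::
        (Γ'.bit (decide (occ F x ≤ cap)) :: List.replicate (freshNat forb) Γ'.ket ++ [Γ'.blank])) := by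
      rw [ocRecs, List.map_append, ← ocRecs, wRecs_append]
      simp [wRecs, ocPay, hcol]
    rw [hrec]
    simp only [hS7, hS6, hS5, hS4, hS3, hS2, hS1]
    funext q
    by_cases q1 : q = kr KR.pr2; · subst q1; simp [hN.pr2]
    rw [Function.update_of_ne q1]
    by_cases q2 : q = kr KR.cols; · subst q2; simp [hN.cols]
    rw [Function.update_of_ne q2]
    by_cases q3 : q = kr KR.oc; · subst q3; simp
    rw [Function.update_of_ne q3, Function.update_of_ne q3]
    by_cases q4 : q = kr KR.c; · subst q4; simp [hN.c]
    rw [Function.update_of_ne q4]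
    by_cases q5 : q = kr KR.fl; · subst q5; simp [hN.fl]
    rw [Function.update_of_ne q5]
    by_cases q6 : q = kr KR.pr; · subst q6; simp
    rw [Function.update_of_ne q6, Function.update_of_ne q4, Function.update_of_ne q6]
    by_cases q7 : q = kr KR.cnt; · subst q7; simp [hN.cnt]
    rw [Function.update_of_ne q7, Function.update_of_ne q5, Function.update_of_ne q7]
    by_cases g1 : q = kr KR.s1; · subst g1; simp [hN.s1]
    by_cases g2 : q = kr KR.md; · subst g2; simp [hN.md]
    by_cases g3 : q = kr KR.ex; · subst g3; simp [hN.ex]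
    by_cases g4 : q = kr KR.ju; · subst g4; simp [hN.ju]
    by_cases g5 : q = kr KR.s2; · subst g5; simp [hN.s2]
    by_cases g6 : q = kr KR.ne; · subst g6; simp [hN.ne]
    by_cases g7 : q = kr KR.fnd; · subst g7; simp [hN.fnd]
    by_cases g8 : q = kr KR.key; · subst g8; simp [hN.key]
    rw [xSt_other _ _ _ _ _ _ _ _ _ _ _ _ _ g1 g2 g3 g4 q5 q7 g5 q2 q6 g6 g7 g8, Function.update_of_ne q1]
  · -- the cost
    have hK : ((12 * freshNat forb + 47) * (wCols forb).length + 10 + 2) * (freshNat forb + 1) ≤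
        ((12 * (Lo * Wf) + 47) * (Lo * Wf) + 10 + 2) * (Lo * Wf + 1) := by
      refine Nat.mul_le_mul ?_ (by omega)
      have := Nat.mul_le_mul (show 12 * freshNat forb + 47 ≤ 12 * (Lo * Wf) + 47 by omega) hWc
      omega
    simp only [← hLo, ← hWf]
    unfold nvCost
    omega

end Literature.Computability.FineGrained.IPRenameM
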